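import Summits.CriticalPhenomena.PercolationContinuityZ3.Theses.PercNearOneGluing
import Summits.CriticalPhenomena.PercolationContinuityZ3.Theorems.PercNearOneGluingAdditiveGluingTieLiftTwoAux
import Summits.CriticalPhenomena.PercolationContinuityZ3.Theorems.PercNearOneGluingAdditiveGluingSpectatorEdgeBHK
import Literature.Probability.Percolation.TwoSetExchange
import HarnessLib

/-!
# Crux `PercNearOneGluing.AdditiveGluing` (stmt-CriticalPhenomena-4576), line `tieline`: E-monotonicity under
# contraction of a spectator pair (registered stub `stub_spectatorEmono_c9`)

Support file (`--supports stmt-CriticalPhenomena-4576`, lead c9, skeleton v18).  No definitions, no named facts, no sorries.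

Weighted graph on `Fin n` (`μ_w = prodBernoulli w`), pair `{u, v}` to be glued at the target `b`, spectator `c`, and a
pair `e = s(c, y)` at the spectator (`c ≠ y`).  Write `μ⁰ = μ_{w[e ↦ 0]}` (pair deleted), `μ¹ = μ_{w[e ↦ 1]}` (pair
contracted), `N = {c ↮ u} ∩ {c ↮ v}` and `E = {u ↮ b} ∩ {v ↔ b} ∩ {c ↮ u}`.

**E-monotonicity (`stub_spectatorEmono_c9`).**  `μ⁰(E) · μ¹(N) ≤ μ¹(E) · μ⁰(N)`, i.e. the ratio `μ(E)/μ(N)` does not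
decrease when the spectator pair is contracted rather than deleted.

Proof.
* Transport (`tieLiftOne_real_one_eq`): `μ¹ = (insert e)_* μ⁰`, and after inserting `e` one has `c ↔ a` iff
  `c ↔ a` or `y ↔ a` before (`tieLiftTwo_reach_insert`).  Hence, with `A = {u ↔ y}`,
  `μ¹(N) ≤ μ⁰(N ∖ A)` and `μ⁰(E ∖ A) ≤ μ¹(E)` (`SpectatorEmono.preimage_insert_N_subset`,
  `SpectatorEmono.subset_preimage_insert_E`), so it suffices to show, for one measure `μ = μ⁰`,
  (KEY) `μ(E ∩ A) · μ(N) ≤ μ(E) · μ(N ∩ A)` (`SpectatorEmono.key`).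
* KEY is a chain of three van den Berg–Häggström–Kahn inequalities (Thm. 1.5, "given `s ↮ t` the variables `1{e ∈ C_s}`,
  `1{e ∉ C_t}` are positively associated", and its version with vertex sets, Thm. 2.1 at `q = 1`), in the event
  ("exchange") form landed in `Literature/Probability/Percolation/TwoClusterExchange.lean`, `TwoSetExchange.lean`:
  with `D = {u ↮ c}`, `D_T = D ∩ {u ↮ b}`,
  (d1) `μ(D_T ∩ A ∩ {b↔v}) · μ(D_T) ≤ μ(D_T ∩ A) · μ(D_T ∩ {b↔v})` (`S = {u}`, `T = {c, b}`: `A` is increasing in `C_u`,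
  `{b ↔ v}` increasing in `C_T`), (d2) `μ(D_T ∩ A) · μ(D) ≤ μ(D ∩ A) · μ(D_T)` (`{u ↮ b}` is decreasing in `C_u`),
  (e) `μ(D ∩ A) · μ(N) ≤ μ(N ∩ A) · μ(D)` (`A` and `{c ↮ v}` are both of type `(+)` for `(C_u, C_c)`); multiplying,
  `μ(E ∩ A)/μ(E) ≤ μ(D_T ∩ A)/μ(D_T) ≤ μ(D ∩ A)/μ(D) ≤ μ(N ∩ A)/μ(N)` (division-free in the file).
* Degenerate case `u = c`: `E = N = ∅`.
[cite: VandenbergHaggstromKahn2005, Thm. 1.5 (p. 7) and Thm. 2.1 (p. 9) at q = 1, Remark 1 after Thm. 1.2 (p. 5)]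
[cite: KozmaNitzan2024, §2.2 (p. 5), the BHK inequalities for two clusters]
-/

namespace Summit.CriticalPhenomena.PercolationContinuityZ3.Cruxes.AdditiveGluing.TieLine

open MeasureTheory Set Literature.Probability.LatticeModels Literature.Probability.Percolation
open Summit.CriticalPhenomena.PercolationContinuityZ3.Theorems

noncomputable section

namespace SpectatorEmono

variable {V : Type*}

/-- The separation event of the blocks `{u}` and `{c, b}` is `{u ↮ c} ∩ {u ↮ b}`. [folklore] -/
theorem setOf_sep_singleton_pair (u c b : V) :
    {ω : BondConfig V | ∀ s ∈ ({u} : Set V), ∀ t ∈ ({c, b} : Set V), ¬ (openGraph ω).Reachable s t} =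
      (openConn u c)ᶜ ∩ (openConn u b)ᶜ := by
  ext ω
  simp only [mem_setOf_eq, mem_singleton_iff, forall_eq, forall_mem_insert, mem_inter_iff, mem_compl_iff,
    openConn]

variable [Fintype V]

/-- **(d1)** BHK Thm. 2.1 (`q = 1`) for the blocks `S = {u}`, `T = {c, b}`: given `D_T = {u ↮ c} ∩ {u ↮ b}`, the
event `{u ↔ y}` (increasing in `C_u`) and the event `{b ↔ v}` (increasing in `C_T`) are negatively correlated:
`μ(D_T ∩ ({u↔y} ∩ {b↔v})) · μ(D_T) ≤ μ(D_T ∩ {u↔y}) · μ(D_T ∩ {b↔v})`.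
[cite: VandenbergHaggstromKahn2005, Thm. 2.1 (p. 9) at q = 1, Remark 1 after Thm. 1.2 (p. 5)] -/
theorem bhk_d1 (w : Sym2 V → unitInterval) (b u v c y : V) :
    (prodBernoulli w).real ((openConn u c)ᶜ ∩ (openConn u b)ᶜ ∩ (openConn u y ∩ openConn b v)) *
        (prodBernoulli w).real ((openConn u c)ᶜ ∩ (openConn u b)ᶜ : Set (BondConfig V)) ≤
      (prodBernoulli w).real ((openConn u c)ᶜ ∩ (openConn u b)ᶜ ∩ openConn u y) *
        (prodBernoulli w).real ((openConn u c)ᶜ ∩ (openConn u b)ᶜ ∩ openConn b v) := by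
  have key := setTwoClusterExchange w ({u} : Set V) ({c, b} : Set V)
    (A₁ := openConn u y) (A₂ := univ) (B₁ := openConn b v) (B₂ := univ)
    (TwoSetExchange.typePlus_openConn_of_mem {u} {c, b} (mem_singleton u) y)
    (fun _ _ _ _ _ => mem_univ _)
    (TwoSetExchange.typeMinus_openConn_of_mem {u} {c, b} (mem_insert_of_mem c (mem_singleton b)) v)
    (fun _ _ _ _ _ => mem_univ _)
  rw [setOf_sep_singleton_pair u c b] at key
  simpa only [inter_univ, univ_inter] using key

/-- **(d2)** BHK Thm. 1.5 for `(C_u, C_c)` given `D = {u ↮ c}` (`u ≠ c`): `{u ↔ y}` (type `(+)`) and `{u ↮ b}`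
(type `(−)`) are negatively correlated: `μ(D ∩ ({u↔y} ∩ {u↮b})) · μ(D) ≤ μ(D ∩ {u↔y}) · μ(D ∩ {u↮b})`.
[cite: VandenbergHaggstromKahn2005, Thm. 1.5 (p. 7)] -/
theorem bhk_d2 (w : Sym2 V → unitInterval) (b u c y : V) (huc : u ≠ c) :
    (prodBernoulli w).real ((openConn u c)ᶜ ∩ (openConn u y ∩ (openConn u b)ᶜ)) *
        (prodBernoulli w).real ((openConn u c)ᶜ : Set (BondConfig V)) ≤
      (prodBernoulli w).real ((openConn u c)ᶜ ∩ openConn u y) *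
        (prodBernoulli w).real ((openConn u c)ᶜ ∩ (openConn u b)ᶜ) := by
  have key := twoClusterExchange w huc
    (A₁ := openConn u y) (A₂ := univ) (B₁ := (openConn u b)ᶜ) (B₂ := univ)
    (typePlus_openConn u c y) (fun _ _ _ _ _ => mem_univ _)
    (typeMinus_not_openConn u c b) (fun _ _ _ _ _ => mem_univ _)
  simpa only [inter_univ, univ_inter] using key

/-- **(e)** BHK Thm. 1.5 for `(C_u, C_c)` given `D = {u ↮ c}` (`u ≠ c`): `{u ↔ y}` and `{c ↮ v}` (both of type `(+)`)
are positively correlated: `μ(D ∩ {u↔y}) · μ(D ∩ {c↮v}) ≤ μ(D ∩ ({u↔y} ∩ {c↮v})) · μ(D)`.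
[cite: VandenbergHaggstromKahn2005, Thm. 1.5 (p. 7)] -/
theorem bhk_e (w : Sym2 V → unitInterval) (u v c y : V) (huc : u ≠ c) :
    (prodBernoulli w).real ((openConn u c)ᶜ ∩ openConn u y) *
        (prodBernoulli w).real ((openConn u c)ᶜ ∩ (openConn c v)ᶜ) ≤
      (prodBernoulli w).real ((openConn u c)ᶜ ∩ (openConn u y ∩ (openConn c v)ᶜ)) *
        (prodBernoulli w).real ((openConn u c)ᶜ : Set (BondConfig V)) := by
  have key := twoClusterExchange w huc
    (A₁ := openConn u y) (A₂ := (openConn c v)ᶜ) (B₁ := univ) (B₂ := univ)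
    (typePlus_openConn u c y) (typePlus_not_openConn u c v)
    (fun _ _ _ _ _ => mem_univ _) (fun _ _ _ _ _ => mem_univ _)
  simpa only [inter_univ, univ_inter] using key

/-- **KEY** (one measure, any weights, `u ≠ c`): with `E = {u ↮ b} ∩ {v ↔ b} ∩ {c ↮ u}`, `N = {c ↮ u} ∩ {c ↮ v}`,
`A = {u ↔ y}`: `μ(E ∩ A) · μ(N) ≤ μ(E) · μ(N ∩ A)` — the chain (d1), (d2), (e).
[cite: VandenbergHaggstromKahn2005, Thm. 1.5 (p. 7), Thm. 2.1 (p. 9) at q = 1] -/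
theorem key (w : Sym2 V → unitInterval) (b u v c y : V) (huc : u ≠ c) :
    (prodBernoulli w).real ((openConn u b)ᶜ ∩ openConn v b ∩ (openConn c u)ᶜ ∩ openConn u y) *
        (prodBernoulli w).real ((openConn c u)ᶜ ∩ (openConn c v)ᶜ : Set (BondConfig V)) ≤
      (prodBernoulli w).real ((openConn u b)ᶜ ∩ openConn v b ∩ (openConn c u)ᶜ) *
        (prodBernoulli w).real ((openConn c u)ᶜ ∩ (openConn c v)ᶜ ∩ openConn u y) := by
  rw [KNPreFKG.openConn_symm c u, KNPreFKG.openConn_symm v b]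
  have d1 := bhk_d1 w b u v c y
  have d2 := bhk_d2 w b u c y huc
  have e := bhk_e w u v c y huc
  have s1 : ((openConn u b)ᶜ ∩ openConn b v ∩ (openConn u c)ᶜ ∩ openConn u y : Set (BondConfig V)) =
      (openConn u c)ᶜ ∩ (openConn u b)ᶜ ∩ (openConn u y ∩ openConn b v) := by
    ext ω; simp only [mem_inter_iff, mem_compl_iff]; tauto
  have s2 : ((openConn u b)ᶜ ∩ openConn b v ∩ (openConn u c)ᶜ : Set (BondConfig V)) =
      (openConn u c)ᶜ ∩ (openConn u b)ᶜ ∩ openConn b v := by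
    ext ω; simp only [mem_inter_iff, mem_compl_iff]; tauto
  have s3 : ((openConn u c)ᶜ ∩ (openConn c v)ᶜ ∩ openConn u y : Set (BondConfig V)) =
      (openConn u c)ᶜ ∩ (openConn u y ∩ (openConn c v)ᶜ) := by
    ext ω; simp only [mem_inter_iff, mem_compl_iff]; tauto
  have s4 : ((openConn u c)ᶜ ∩ (openConn u y ∩ (openConn u b)ᶜ) : Set (BondConfig V)) =
      (openConn u c)ᶜ ∩ (openConn u b)ᶜ ∩ openConn u y := by
    ext ω; simp only [mem_inter_iff, mem_compl_iff]; tauto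
  rw [s1, s2, s3]
  rw [s4] at d2
  set μ := prodBernoulli w with hμ
  set x := μ.real ((openConn u c)ᶜ ∩ (openConn u b)ᶜ ∩ (openConn u y ∩ openConn b v)) with hx
  set mT := μ.real ((openConn u c)ᶜ ∩ (openConn u b)ᶜ : Set (BondConfig V)) with hmT
  set aT := μ.real ((openConn u c)ᶜ ∩ (openConn u b)ᶜ ∩ openConn u y) with haT
  set mE := μ.real ((openConn u c)ᶜ ∩ (openConn u b)ᶜ ∩ openConn b v) with hmE
  set mD := μ.real ((openConn u c)ᶜ : Set (BondConfig V)) with hmD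
  set aD := μ.real ((openConn u c)ᶜ ∩ openConn u y) with haD
  set mN := μ.real ((openConn u c)ᶜ ∩ (openConn c v)ᶜ) with hmN
  set aN := μ.real ((openConn u c)ᶜ ∩ (openConn u y ∩ (openConn c v)ᶜ)) with haN
  have hx0 : 0 ≤ x := measureReal_nonneg
  have hmT0 : 0 ≤ mT := measureReal_nonneg
  have hmE0 : 0 ≤ mE := measureReal_nonneg
  have hmD0 : 0 ≤ mD := measureReal_nonneg
  have hmN0 : 0 ≤ mN := measureReal_nonneg
  have haN0 : 0 ≤ aN := measureReal_nonneg
  have hx_le : x ≤ mT := measureReal_mono inter_subset_left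
  have hT_le : mT ≤ mD := measureReal_mono inter_subset_left
  by_cases hT : mT = 0
  · have hx' : x = 0 := le_antisymm (hx_le.trans hT.le) hx0
    rw [hx', zero_mul]
    exact mul_nonneg hmE0 haN0
  by_cases hD : mD = 0
  · exact absurd (le_antisymm (hT_le.trans hD.le) hmT0) hT
  have hTpos : 0 < mT := lt_of_le_of_ne hmT0 (Ne.symm hT)
  have hDpos : 0 < mD := lt_of_le_of_ne hmD0 (Ne.symm hD)
  have c1 : x * mT * mD * mN ≤ aT * mE * mD * mN :=
    mul_le_mul_of_nonneg_right (mul_le_mul_of_nonneg_right d1 hmD0) hmN0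
  have c2 : aT * mD * mE * mN ≤ aD * mT * mE * mN :=
    mul_le_mul_of_nonneg_right (mul_le_mul_of_nonneg_right d2 hmE0) hmN0
  have c3 : aD * mN * mE * mT ≤ aN * mD * mE * mT :=
    mul_le_mul_of_nonneg_right (mul_le_mul_of_nonneg_right e hmE0) hmT0
  have h : x * mN * (mT * mD) ≤ mE * aN * (mT * mD) := by
    have e1 : x * mN * (mT * mD) = x * mT * mD * mN := by ring
    have e2 : aT * mE * mD * mN = aT * mD * mE * mN := by ring
    have e3 : aD * mT * mE * mN = aD * mN * mE * mT := by ring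
    have e4 : aN * mD * mE * mT = mE * aN * (mT * mD) := by ring
    rw [e1, ← e4]
    exact c1.trans (e2 ▸ c2.trans (e3 ▸ c3))
  exact le_of_mul_le_mul_right h (mul_pos hTpos hDpos)

end SpectatorEmono

namespace SpectatorEmono

variable {n : ℕ}

/-- After inserting the pair `s(c, y)` (`c ≠ y`): `c ↔ a` iff `c ↔ a` or `y ↔ a` before. [folklore] -/
theorem reach_insert_left (ω : BondConfig (Fin n)) {c y : Fin n} (hcy : c ≠ y) (a : Fin n) :
    (openGraph (insert s(c, y) ω)).Reachable c a ↔ (openGraph ω).Reachable c a ∨ (openGraph ω).Reachable y a := by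
  rw [tieLiftTwo_reach_insert ω hcy]
  have hcc : (openGraph ω).Reachable c c := SimpleGraph.Reachable.refl c
  tauto

/-- Pull-back of `N = {c ↮ u} ∩ {c ↮ v}` under `insert s(c, y)` lies in `N ∖ {u ↔ y}`. [folklore] -/
theorem preimage_insert_N_subset (u v : Fin n) {c y : Fin n} (hcy : c ≠ y) :
    (fun ω : BondConfig (Fin n) => insert s(c, y) ω) ⁻¹' ((openConn c u)ᶜ ∩ (openConn c v)ᶜ) ⊆
      (openConn c u)ᶜ ∩ (openConn c v)ᶜ ∩ (openConn u y)ᶜ := by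
  intro ω hω
  simp only [mem_preimage, mem_inter_iff, mem_compl_iff, openConn, mem_setOf_eq, reach_insert_left ω hcy] at hω
  simp only [mem_inter_iff, mem_compl_iff, openConn, mem_setOf_eq]
  obtain ⟨h1, h2⟩ := hω
  exact ⟨⟨fun h => h1 (Or.inl h), fun h => h2 (Or.inl h)⟩, fun h => h1 (Or.inr h.symm)⟩

/-- `E ∖ {u ↔ y}` lies in the pull-back of `E = {u ↮ b} ∩ {v ↔ b} ∩ {c ↮ u}` under `insert s(c, y)`: if
`u ↮ b`, `v ↔ b`, `c ↮ u`, `u ↮ y`, then after inserting `s(c, y)` still `u ↮ b` (a new `u–b` path would use the new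
pair, so `u ↔ c` or `u ↔ y` before), `v ↔ b` (monotonicity) and `c ↮ u`. [folklore] -/
theorem subset_preimage_insert_E (b u v : Fin n) {c y : Fin n} (hcy : c ≠ y) :
    (openConn u b)ᶜ ∩ openConn v b ∩ (openConn c u)ᶜ ∩ (openConn u y)ᶜ ⊆
      (fun ω : BondConfig (Fin n) => insert s(c, y) ω) ⁻¹'
        ((openConn u b)ᶜ ∩ openConn v b ∩ (openConn c u)ᶜ) := by
  intro ω hω
  simp only [mem_inter_iff, mem_compl_iff, openConn, mem_setOf_eq] at hω
  obtain ⟨⟨⟨hub, hvb⟩, hcu⟩, huy⟩ := hω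
  simp only [mem_preimage, mem_inter_iff, mem_compl_iff, openConn, mem_setOf_eq,
    tieLiftTwo_reach_insert ω hcy]
  refine ⟨⟨?_, Or.inl hvb⟩, ?_⟩
  · rintro (h | ⟨h1 | h1, -⟩)
    · exact hub h
    · exact hcu h1.symm
    · exact huy h1
  · rintro (h | ⟨-, h2 | h2⟩)
    · exact hcu h
    · exact hcu h2
    · exact huy h2.symm

/-- `μ(X ∩ A) + μ(X ∩ Aᶜ) = μ(X)` on the finite configuration space. [folklore] -/
theorem real_inter_add_inter_compl (μ : Measure (BondConfig (Fin n))) [IsFiniteMeasure μ]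
    (X A : Set (BondConfig (Fin n))) : μ.real (X ∩ A) + μ.real (X ∩ Aᶜ) = μ.real X := by
  rw [← sdiff_eq, measureReal_inter_add_sdiff MeasurableSet.of_discrete]

end SpectatorEmono

open SpectatorEmono in
/-- **Registered stub `stub_spectatorEmono_c9`** (E-monotonicity; line `tieline`, crux `AdditiveGluing`): for the pair
`e = s(c, y)` at the spectator, `μ⁰ = μ_{w[e↦0]}`, `μ¹ = μ_{w[e↦1]}`, `E = {u↮b} ∩ {v↔b} ∩ {c↮u}`, `N = {c↮u} ∩ {c↮v}`:
`μ⁰(E)·μ¹(N) ≤ μ¹(E)·μ⁰(N)`.  Transport along `insert e` plus the KEY inequality `μ(E ∩ A)μ(N) ≤ μ(E)μ(N ∩ A)`,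
`A = {u ↔ y}`, itself a chain of three vdBHK exchange inequalities; `u = c` is degenerate (`E = N = ∅`).
[cite: VandenbergHaggstromKahn2005, Thm. 1.5 (p. 7), Thm. 2.1 (p. 9) at q = 1] [cite: KozmaNitzan2024, §2.2 (p. 5)] -/
theorem stub_spectatorEmono_c9 : ∀ (n : ℕ) (w : Sym2 (Fin n) → unitInterval) (b u v c y : Fin n), c ≠ y → y ≠ u → y ≠ v → (Literature.Probability.LatticeModels.prodBernoulli (Function.update w s(c, y) 0)).real ((Literature.Probability.Percolation.openConn u b)ᶜ ∩ Literature.Probability.Percolation.openConn v b ∩ (Literature.Probability.Percolation.openConn c u)ᶜ : Set (Literature.Probability.Percolation.BondConfig (Fin n))) * (Literature.Probability.LatticeModels.prodBernoulli (Function.update w s(c, y) 1)).real ((Literature.Probability.Percolation.openConn c u)ᶜ ∩ (Literature.Probability.Percolation.openConn c v)ᶜ : Set (Literature.Probability.Percolation.BondConfig (Fin n))) ≤ (Literature.Probability.LatticeModels.prodBernoulli (Function.update w s(c, y) 1)).real ((Literature.Probability.Percolation.openConn u b)ᶜ ∩ Literature.Probability.Percolation.openConn v b ∩ (Literature.Probability.Percolation.openConn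 c u)ᶜ : Set (Literature.Probability.Percolation.BondConfig (Fin n))) * (Literature.Probability.LatticeModels.prodBernoulli (Function.update w s(c, y) 0)).real ((Literature.Probability.Percolation.openConn c u)ᶜ ∩ (Literature.Probability.Percolation.openConn c v)ᶜ : Set (Literature.Probability.Percolation.BondConfig (Fin n))) := by
  intro n w b u v c y hcy _ _
  by_cases huc : u = c
  · subst huc
    simp only [SpectatorEdgeBHK.compl_openConn_self, inter_empty, empty_inter, measureReal_empty, mul_zero, le_refl]
  -- notation
  set μ0 := prodBernoulli (Function.update w s(c, y) 0) with hμ0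
  set E : Set (BondConfig (Fin n)) := (openConn u b)ᶜ ∩ openConn v b ∩ (openConn c u)ᶜ with hE
  set N : Set (BondConfig (Fin n)) := (openConn c u)ᶜ ∩ (openConn c v)ᶜ with hN
  -- transport along `insert e`
  have hN1 : (prodBernoulli (Function.update w s(c, y) 1)).real N ≤ μ0.real (N ∩ (openConn u y)ᶜ) := by
    rw [tieLiftOne_real_one_eq]
    exact measureReal_mono (preimage_insert_N_subset u v hcy)
  have hE1 : μ0.real (E ∩ (openConn u y)ᶜ) ≤ (prodBernoulli (Function.update w s(c, y) 1)).real E := by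
    rw [tieLiftOne_real_one_eq]
    exact measureReal_mono (subset_preimage_insert_E b u v hcy)
  have hNs := real_inter_add_inter_compl μ0 N (openConn u y)
  have hEs := real_inter_add_inter_compl μ0 E (openConn u y)
  have hK : μ0.real (E ∩ openConn u y) * μ0.real N ≤ μ0.real E * μ0.real (N ∩ openConn u y) :=
    key (Function.update w s(c, y) 0) b u v c y huc
  have hE0 : 0 ≤ μ0.real E := measureReal_nonneg
  have hN0 : 0 ≤ μ0.real N := measureReal_nonneg
  calc μ0.real E * (prodBernoulli (Function.update w s(c, y) 1)).real N
      ≤ μ0.real E * μ0.real (N ∩ (openConn u y)ᶜ) := mul_le_mul_of_nonneg_left hN1 hE0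
    _ = μ0.real E * μ0.real N - μ0.real E * μ0.real (N ∩ openConn u y) := by rw [← hNs]; ring
    _ ≤ μ0.real E * μ0.real N - μ0.real (E ∩ openConn u y) * μ0.real N := by linarith
    _ = μ0.real (E ∩ (openConn u y)ᶜ) * μ0.real N := by rw [← hEs]; ring
    _ ≤ (prodBernoulli (Function.update w s(c, y) 1)).real E * μ0.real N := mul_le_mul_of_nonneg_right hE1 hN0

end

end Summit.CriticalPhenomena.PercolationContinuityZ3.Cruxes.AdditiveGluing.TieLine
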